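/-
Copyright (c) 2026 the pub-hodgecm-mathlib formalisation cell (harness21).  Prover seat hodgecm-mathlib-LH4-p06 (g5), Track A «(D-RAM) FOUR-FRAME», unit U2H, census leaf
(ρ2b′-X) — SOCKET (C) `orderCountCensusC` (type RamM): the letter `hq2 : 2 ∣ q` of ★ p858102∕p858131∕p858235 at a dyadic place (LH4-p04 (g5) SOCKET (C) LEAD LINE #13).  2026-09-04.
-/
import Mathlib.FieldTheory.Finite.Basic
import Summits.HodgeConjecture.HodgeConjecture.Theorems.F0P3cDyRamToricLevelCensusRamMTopCells   -- ★ p858102 (this seat): the consumer of `hq2`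
import HarnessLib

/-!
# `|2| < 1 ⇒ 2 ∣ #𝓀` — the residue field of a dyadic valued field has even cardinality

Cell `hodgecm-mathlib` (D-0151), FLOOR 0, crux H413 = `stmt-HodgeConjecture-24833`; squad F0∕P3c∕LH4; lane `--supports stmt-HodgeConjecture-24833 --as helper` (count-neutral).
THEOREMS ONLY.  Socket served: LH4-p04 (g5)'s SOCKET (C) `orderCountCensusC`, letter `hq2 : 2 ∣ q` (`q = #𝓀_M`) consumed by ★ p858102 `ncard_levelSetDep_top_cast_eq_of_bit`,
★ p858131, ★ p858235 (the halved Mars indices `q^n ∕ 2` are exact only for even `q`); HEAD.C v2 carries `h2v : |2| < 1`.  `two_dvd_natCard_residueField_of_v_two_lt_one`: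
`|2| < 1` puts `2` in the maximal ideal of `𝒪`, so the residue field has characteristic `2` (★ `CharP.ringChar_of_prime_eq_zero`) and even cardinality
(★ `FiniteField.even_card_iff_char_two`).
HONEST LABEL.  Count-neutral (`--supports`); nothing of (ρ2b′-X) is asserted — `HC_CM` is proved only modulo the 7 printed citations (2 remaining named inputs:
hLiu418 = `stmt-HodgeConjecture-24832`, h413 = `stmt-HodgeConjecture-24833`) until rung 0 closes.

## References
* [Serre1979] J.-P. Serre, *Local Fields*, GTM 67 (1979): Ch. I §1 (the residue field of a discrete valuation ring), Ch. IV §2 (wild ramification is a `p`-phenomenon).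
-/

set_option autoImplicit false

namespace Summit.HodgeConjecture.HodgeConjecture.Cruxes.H413.F0P3cDyRamToricLevelCensusRamM

open IsLocalRing WithZero
open scoped Valued

variable {K : Type} [Field K] [Valued K ℤᵐ⁰]

/-- **`|2| < 1 ⇒ 2 ∣ #𝓀`**: at a dyadic place the residue field has characteristic `2`, hence even cardinality. [cite: Serre1979, Ch. I §1] -/
theorem two_dvd_natCard_residueField_of_v_two_lt_one [Finite 𝓀[K]] (h2v : Valued.v (2 : K) < 1) {q : ℕ} (hq : Nat.card 𝓀[K] = q) : 2 ∣ q := by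
  classical
  haveI : Fintype 𝓀[K] := Fintype.ofFinite _
  -- `2 ∈ 𝓂`: a valuation integer of valuation `< 1` is not a unit
  have hmem : (2 : 𝒪[K]) ∈ maximalIdeal 𝒪[K] := by
    rw [mem_maximalIdeal, mem_nonunits_iff]
    intro hu
    have h1 := (Valuation.integer.integers (Valued.v (R := K))).isUnit_iff_valuation_eq_one.1 hu
    have h2 : (algebraMap 𝒪[K] K) 2 = (2 : K) := map_ofNat _ 2
    rw [h2] at h1
    exact absurd h1 h2v.ne
  have h20 : ((2 : ℕ) : 𝓀[K]) = 0 := by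
    have h1 : residue 𝒪[K] (2 : 𝒪[K]) = 0 := (residue_eq_zero_iff _).2 hmem
    rwa [map_ofNat] at h1
  have hchar : ringChar 𝓀[K] = 2 := CharP.ringChar_of_prime_eq_zero Nat.prime_two h20
  have heven := FiniteField.even_card_of_char_two hchar
  rw [← hq, Nat.card_eq_fintype_card]
  omega

end Summit.HodgeConjecture.HodgeConjecture.Cruxes.H413.F0P3cDyRamToricLevelCensusRamM
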